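import Summits.AtomisticToContinuum.Crystallization.Theorems.ChartedZeroExcessLayeredLatticeLiouvilleZZZD
import Summits.AtomisticToContinuum.Crystallization.Theorems.ChartedZeroExcessLayeredLatticeLiouvilleZZP

/-!
# (B′.6e) W1 junctions ZZZE — EVERY JUNCTION OF RECORD SURVIVES THE TWO-RADIUS PIECES VERBATIM (proof file: 7 theorems, 0 def)

Lineage `stmt-AtomisticToContinuum-26636` (route ChartedPlanarOrder), lens-2 g81, option W1-β of FINDING «IC» (critic row 1508), memo «W1-CONSUMERS».
Imports the statement file ZZZD (the six `₂`-pieces) and tree ZZP (the pointwise Θ-junction `exists_isBondLabel_of_slabIso`).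

* `singleVariantP₂_of_bondLabel₂`            (GL₂) ∧ (GC₂) ⟹ (SV₂)                                  [ZC `singleVariantP_of_bondLabel` verbatim]
* `enclosureNetP_of_variantLabel₂`           (SV₂) ∧ (AR₂) ∧ (LN₂) ⟹ (EN) — (EN)'s statement UNCHANGED  [ZB `enclosureNetP_of_variantLabel`; `coreOf_mono`]
* `coreOccupancyP_of_variantLabel₂`          … ∧ (CV₂) ⟹ (OC) — UNCHANGED; the cool/core split of ZB `coreOccupancyP_of_variantLabel` moved from `r`
                                             to `rΘ` (`dist_lab_le_of_label` verbatim at `(r, rsh) := (rΘ, r + rsh − rΘ)`)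
* `enclosureNetP_instance_of_variantLabel₂`, `coreOccupancyP_instance_of_variantLabel₂` — record dials, `rΘ = 145/16`
* `coolMoatSlavedFillingP_tubeSlot_of_bondLabel₂` — THE DOCKET SLOT from (SC) ∧ (GL₂) ∧ (GC₂) ∧ (AR₂) ∧ (LN₂) ∧ (CV₂) ∧ (X1) ∧ (X2ᴸ♮): the SAME leaf
  `CoolMoatSlavedFillingP ϑc (1/100) (1/10) 8 4 12 16 16 (1/2) 1 2 (1/16) (1/50)` as ZB `coolMoatSlavedFillingP_tubeSlot_of_variantLabel` — nothing above
  ZB moves under W1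
* `exists_isBondLabel_of_slabIso_record₂` — (GL₂)'s pointwise Θ-junction: tree ZZP at `(r, rI, ℓ, RΘ, Rl) = (145/16, 163/16, 43/2, 13, 21/2)` via
  `IsCoolShadowCrystal.mono` (`10 ≤ 163/16`); its `hX₃` / `hK` binders are LITERALLY clauses 5 / 6 of rider ZZZC `slabIso_package_reg` (moat
  `(145/16, 43/2)`, partners `< 13`; `Kread` sheets within `179/16 ⊇ 145/16`); side conditions `145/16 + 28/25 + 10⁻⁴ ≤ 163/16`, `163/16 + 28/25 + 10⁻⁴ < 13`,
  `163/16 < 21/2` by `norm_num`.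

0 sorry; no new definitions; no new real-side estimate (bookkeeping only).
-/


open scoped BigOperators Classical InnerProductSpace RealInnerProductSpace
open MeasureTheory Set Metric Filter Topology
open Summit.AtomisticToContinuum.Crystallization.Theorems.ChartedPlanarOrderRigidityDoor (E3 IsClean)
open Summit.AtomisticToContinuum.Crystallization.Theorems.ChartedPlanarOrderDensityDichotomy (μS IsSep)
open Summit.AtomisticToContinuum.Crystallization.Theorems.ChartedPlanarOrderCleanScaleP (IsCleanP IsDoorSetP isCleanP_one_iff isCleanP_mono)
open Summit.AtomisticToContinuum.Crystallization.Theorems.ChartedPlanarOrderMesoCut (LayeredHom EnvClose)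
open Summit.AtomisticToContinuum.Crystallization.Theorems.ChartedPlanarOrderDoorLayeredOsc (IsTwoShellAffineGood)
open Literature.MathematicalPhysics.StatisticalMechanics (lennardJones)

namespace Summit.AtomisticToContinuum.Crystallization.Theorems.ChartedZeroExcessLayeredLatticeLiouville

section W1Junctions

/-- (GL₂) ∧ (GC₂) ⟹ (SV₂) — ZC's junction verbatim. -/
theorem singleVariantP₂_of_bondLabel₂ {ϑc ϑp r rΘ q rsh rm σ ϑr Rs ε rI ℓ τ aHi Λ θ s : ℝ}
    (hGL : BondLabelP₂ ϑc ϑp r rΘ q rsh rm σ ϑr Rs ε rI ℓ aHi Λ θ s) (hGC : BondCoherenceP₂ ϑc ϑp r rΘ q rsh rm σ ϑr Rs ε rI ℓ τ aHi Λ θ s) :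
    SingleVariantP₂ ϑc ϑp r rΘ q rsh rm σ ϑr Rs ε rI ℓ τ aHi Λ θ s := by
  intro δ hδ a ha S hS hsum hgood L w hL x₀ K hKS hKq hTp hTc L' w' U t hC
  obtain ⟨lab, hlab⟩ := hGL δ hδ a ha S hS hsum hgood L w hL x₀ K hKS hKq hTp hTc L' w' U t hC
  obtain ⟨h₂, h₃⟩ := hGC δ hδ a ha S hS hsum hgood L w hL x₀ K hKS hKq hTp hTc L' w' U t hC lab hlab
  exact ⟨lab, hlab.1, h₂, h₃, hlab.2.2.2⟩

/-- (SV₂) ∧ (AR₂) ∧ (LN₂) ⟹ (EN) — (EN)'s statement is UNCHANGED (domain `coreOf S K r ⊆ coreOf S K rΘ`, chain sites := labels, registration := (AR₂)):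
ZB's `enclosureData_of_label` applies verbatim at `(r, rsh) := (rΘ, r + rsh − rΘ)`. -/
theorem enclosureNetP_of_variantLabel₂ {ϑc ϑp r rΘ q rsh rm σ ϑr Rs ε rI ℓ τ ε₁ ζ κ κ₂ Dm aHi Λ θ s : ℝ}
    (hτ₀ : 0 ≤ τ) (hτ : 3 * τ ≤ ε₁) (hrℓ : r < ℓ) (hrmℓ : rm < ℓ) (hrΘ : r ≤ rΘ)
    (hSV : SingleVariantP₂ ϑc ϑp r rΘ q rsh rm σ ϑr Rs ε rI ℓ τ aHi Λ θ s)
    (hAR : AnchorRegistrationP₂ ϑc ϑp r rΘ q rsh rm σ ϑr Rs ε rI ℓ τ ε₁ aHi Λ θ s)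
    (hLN : LabelledNetP₂ ϑc ϑp r rΘ q rsh rm σ ϑr Rs ε rI ℓ τ ζ κ κ₂ Dm aHi Λ θ s) :
    EnclosureNetP ϑc ϑp r q rsh rm σ ϑr Rs ε rI ℓ ε₁ ζ κ κ₂ Dm aHi Λ θ s := by
  intro δ hδ a ha S hS hsum hgood L w hLw x₀ K hKS hKq hmild hcool L' w' U t hC x hx
  obtain ⟨lab, hlab⟩ := hSV δ hδ a ha S hS hsum hgood L w hLw x₀ K hKS hKq hmild hcool L' w' U t hC
  have hAR' := hAR δ hδ a ha S hS hsum hgood L w hLw x₀ K hKS hKq hmild hcool L' w' U t hC lab hlab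
  have hLN' := hLN δ hδ a ha S hS hsum hgood L w hLw x₀ K hKS hKq hmild hcool L' w' U t hC lab hlab x (coreOf_mono S K hrΘ hx)
  obtain ⟨hxS, k, hk, hxk⟩ := hx
  exact ⟨lab x, hlab.1 x hxS ⟨k, hk, lt_of_le_of_lt hxk hrℓ⟩, fun u hu => enclosureData_of_label hτ₀ hτ hrmℓ hlab hAR' (hLN' u hu)⟩

/-- (SV₂) ∧ (AR₂) ∧ (LN₂) ∧ (CV₂) ⟹ (OC) — (OC)'s statement is UNCHANGED; the cool/core case split of ZB l.240 moves from `r` to `rΘ`: a labelled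
atom `p` with `rΘ < d(p, K)` is pinned by clause (iv); otherwise `p ∈ coreOf S K rΘ` is served by (LN₂) and pinned to its label by ZB's
`dist_lab_le_of_label` verbatim (at `(r, rsh) := (rΘ, r + rsh − rΘ)`). -/
theorem coreOccupancyP_of_variantLabel₂ {ϑc ϑp r rΘ q rsh rm σ ϑr Rs ε rI ℓ τ ε₁ ζ κ κ₂ Dm D₀ d d₁ aHi Λ θ s : ℝ}
    (hϑp : 0 ≤ ϑp) (hε₁ : 0 ≤ ε₁) (hζ : 0 ≤ ζ) (hκ₀ : 0 < κ) (hκ₁ : κ ≤ 1) (hκ₂ : 0 < κ₂) (hκ₂₁ : κ₂ ≤ 1)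
    (hA : 3 * ϑp + 2 * ε₁ + ζ ≤ κ * d) (hA₂ : 3 * ϑp + 2 * ε₁ + ζ ≤ κ₂ * D₀) (hgap : D₀ < 2 * κ * Dm) (hBη : 2 * ϑp + 2 * ε₁ ≤ Dm)
    (hBκ : 2 * ϑp + 2 * ε₁ ≤ κ * d) (hB : (2 * ϑp + 2 * ε₁) * (2 * Dm - (2 * ϑp + 2 * ε₁)) ≤ d * (2 * κ * Dm - D₀))
    (hτ₀ : 0 ≤ τ) (hτ : 3 * τ ≤ ε₁) (hrmℓ : rm < ℓ) (hεd₁ : ε ≤ d₁) (hdd₁ : d ≤ d₁)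
    (hSV : SingleVariantP₂ ϑc ϑp r rΘ q rsh rm σ ϑr Rs ε rI ℓ τ aHi Λ θ s)
    (hAR : AnchorRegistrationP₂ ϑc ϑp r rΘ q rsh rm σ ϑr Rs ε rI ℓ τ ε₁ aHi Λ θ s)
    (hLN : LabelledNetP₂ ϑc ϑp r rΘ q rsh rm σ ϑr Rs ε rI ℓ τ ζ κ κ₂ Dm aHi Λ θ s)
    (hCV : LabelCoveringP₂ ϑc ϑp r rΘ q rsh rm σ ϑr Rs ε rI ℓ τ aHi Λ θ s) :
    CoreOccupancyP ϑc ϑp r q rsh rm σ ϑr Rs ε rI ℓ d₁ aHi Λ θ s := by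
  intro δ hδ a ha S hS hsum hgood L w hLw x₀ K hKS hKq hmild hcool L' w' U t hC c hc hck
  obtain ⟨lab, hlab⟩ := hSV δ hδ a ha S hS hsum hgood L w hLw x₀ K hKS hKq hmild hcool L' w' U t hC
  have hAR' := hAR δ hδ a ha S hS hsum hgood L w hLw x₀ K hKS hKq hmild hcool L' w' U t hC lab hlab
  have hLN' := hLN δ hδ a ha S hS hsum hgood L w hLw x₀ K hKS hKq hmild hcool L' w' U t hC lab hlab
  obtain ⟨p, ⟨hpS, k, hk, hpk⟩, hpc⟩ := hCV δ hδ a ha S hS hsum hgood L w hLw x₀ K hKS hKq hmild hcool L' w' U t hC lab hlab c hc hck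
  refine ⟨p, hpS, ?_⟩
  rw [← hpc]
  by_cases hfar : ∀ k ∈ K, rΘ < dist p k
  · exact (hlab.2.2.2 p hpS ⟨k, hk, lt_of_le_of_lt hpk hrmℓ⟩ hfar).trans hεd₁
  · push Not at hfar
    obtain ⟨k', hk', hpk'⟩ := hfar
    exact (dist_lab_le_of_label hϑp hε₁ hζ hκ₀ hκ₁ hκ₂ hκ₂₁ hA hA₂ hgap hBη hBκ hB hτ₀ hτ hrmℓ hlab hAR'
      (hLN' p ⟨hpS, k', hk', hpk'⟩)).trans hdd₁

/-- (EN) at the record dials from the `₂`-pieces at `rΘ = 145/16`. -/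
theorem enclosureNetP_instance_of_variantLabel₂ {ϑc : ℝ}
    (hSV : SingleVariantP₂ ϑc (1 / 10) 8 (145 / 16) 4 12 16 (17 / 20) (1 / 10000) 5 (1 / 10000) 10 (43 / 2) (1 / 3000) 1 2 (1 / 16) (1 / 50))
    (hAR : AnchorRegistrationP₂ ϑc (1 / 10) 8 (145 / 16) 4 12 16 (17 / 20) (1 / 10000) 5 (1 / 10000) 10 (43 / 2) (1 / 3000) (1 / 1000) 1 2
      (1 / 16) (1 / 50))
    (hLN : LabelledNetP₂ ϑc (1 / 10) 8 (145 / 16) 4 12 16 (17 / 20) (1 / 10000) 5 (1 / 10000) 10 (43 / 2) (1 / 3000) (1 / 100) (4 / 5) (1 / 2)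
      2 1 2 (1 / 16) (1 / 50)) :
    EnclosureNetP ϑc (1 / 10) 8 4 12 16 (17 / 20) (1 / 10000) 5 (1 / 10000) 10 (43 / 2) (1 / 1000) (1 / 100) (4 / 5) (1 / 2) 2 1 2 (1 / 16)
      (1 / 50) :=
  enclosureNetP_of_variantLabel₂ (by norm_num) (by norm_num) (by norm_num) (by norm_num) (by norm_num) hSV hAR hLN

/-- (OC) at the record dials from the `₂`-pieces at `rΘ = 145/16`. -/
theorem coreOccupancyP_instance_of_variantLabel₂ {ϑc : ℝ}
    (hSV : SingleVariantP₂ ϑc (1 / 10) 8 (145 / 16) 4 12 16 (17 / 20) (1 / 10000) 5 (1 / 10000) 10 (43 / 2) (1 / 3000) 1 2 (1 / 16) (1 / 50))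
    (hAR : AnchorRegistrationP₂ ϑc (1 / 10) 8 (145 / 16) 4 12 16 (17 / 20) (1 / 10000) 5 (1 / 10000) 10 (43 / 2) (1 / 3000) (1 / 1000) 1 2
      (1 / 16) (1 / 50))
    (hLN : LabelledNetP₂ ϑc (1 / 10) 8 (145 / 16) 4 12 16 (17 / 20) (1 / 10000) 5 (1 / 10000) 10 (43 / 2) (1 / 3000) (1 / 100) (4 / 5) (1 / 2)
      2 1 2 (1 / 16) (1 / 50))
    (hCV : LabelCoveringP₂ ϑc (1 / 10) 8 (145 / 16) 4 12 16 (17 / 20) (1 / 10000) 5 (1 / 10000) 10 (43 / 2) (1 / 3000) 1 2 (1 / 16) (1 / 50)) :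
    CoreOccupancyP ϑc (1 / 10) 8 4 12 16 (17 / 20) (1 / 10000) 5 (1 / 10000) 10 (43 / 2) (2 / 5) 1 2 (1 / 16) (1 / 50) :=
  coreOccupancyP_of_variantLabel₂ (D₀ := 2 / 3) (d := 2 / 5) (by norm_num) (by norm_num) (by norm_num) (by norm_num) (by norm_num) (by norm_num)
    (by norm_num) (by norm_num) (by norm_num) (by norm_num) (by norm_num) (by norm_num) (by norm_num) (by norm_num) (by norm_num) (by norm_num)
    (by norm_num) le_rfl hSV hAR hLN hCV

/-- THE DOCKET SLOT from (SC) ∧ (GL₂) ∧ (GC₂) ∧ (AR₂) ∧ (LN₂) ∧ (CV₂) ∧ (X1) ∧ (X2ᴸ♮) — the SAME leaf `CoolMoatSlavedFillingP ϑc (1/100) (1/10) 8 4 12 16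
16 (1/2) 1 2 (1/16) (1/50)` as ZB l.307: nothing above ZB moves under W1. -/
theorem coolMoatSlavedFillingP_tubeSlot_of_bondLabel₂ {ϑc lam : ℝ} (hlam : 0 < lam)
    (hSC : CoolZoneShadowCrystalP ϑc (1 / 10) 8 4 12 16 (17 / 20) (1 / 10000) 5 (1 / 10000) 10 (43 / 2) 1 2 (1 / 16) (1 / 50))
    (hGL : BondLabelP₂ ϑc (1 / 10) 8 (145 / 16) 4 12 16 (17 / 20) (1 / 10000) 5 (1 / 10000) 10 (43 / 2) 1 2 (1 / 16) (1 / 50))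
    (hGC : BondCoherenceP₂ ϑc (1 / 10) 8 (145 / 16) 4 12 16 (17 / 20) (1 / 10000) 5 (1 / 10000) 10 (43 / 2) (1 / 3000) 1 2 (1 / 16) (1 / 50))
    (hAR : AnchorRegistrationP₂ ϑc (1 / 10) 8 (145 / 16) 4 12 16 (17 / 20) (1 / 10000) 5 (1 / 10000) 10 (43 / 2) (1 / 3000) (1 / 1000) 1 2
      (1 / 16) (1 / 50))
    (hLN : LabelledNetP₂ ϑc (1 / 10) 8 (145 / 16) 4 12 16 (17 / 20) (1 / 10000) 5 (1 / 10000) 10 (43 / 2) (1 / 3000) (1 / 100) (4 / 5) (1 / 2)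
      2 1 2 (1 / 16) (1 / 50))
    (hCV : LabelCoveringP₂ ϑc (1 / 10) 8 (145 / 16) 4 12 16 (17 / 20) (1 / 10000) 5 (1 / 10000) 10 (43 / 2) (1 / 3000) 1 2 (1 / 16) (1 / 50))
    (hX1 : TubeConvexityP ϑc (1 / 100) (1 / 10) 8 4 12 16 16 (1 / 2) (1 / 5000) 5 (3 / 400) (3 / 400) (1 / 10) lam 1 2 (1 / 16) (1 / 50))
    (hX2 : ShadowLoadedTubeAprioriP ϑc (1 / 100) (1 / 10) 8 4 12 16 16 (1 / 2) (1 / 5000) 5 (3 / 400) (3 / 400) (1 / 10) (17 / 20) (1 / 10000)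
      (1 / 10000) (19 / 4) (21 / 4) (1 / 200) (1 / 200) (1 / 20) 1 2 (1 / 16) (1 / 50)) :
    CoolMoatSlavedFillingP ϑc (1 / 100) (1 / 10) 8 4 12 16 16 (1 / 2) 1 2 (1 / 16) (1 / 50) :=
  have hSV := singleVariantP₂_of_bondLabel₂ hGL hGC
  coolMoatSlavedFillingP_tubeSlot_of_enclosure hlam hSC (enclosureNetP_instance_of_variantLabel₂ hSV hAR hLN)
    (coreOccupancyP_instance_of_variantLabel₂ hSV hAR hLN hCV) hX1 hX2

/-- (GL₂)'s POINTWISE Θ-JUNCTION AT `rΘ = 145/16` (PROVED from TREE ZZP, no new mathematics): the record cool shadow crystal (`(r, rI) = (8, 10)`,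
weakened by `IsCoolShadowCrystal.mono` to `(145/16, 163/16)`), X_Θ's clauses EXACTLY as `slabIso_package_reg` (ZZZC v2) delivers them — `hX₃` =
clause 5 (partnered collar on `moatIn S K (145/16) (43/2)` within `13`), `hK` = clause 6 (`Kread` sheets within `179/16 ⊇ 145/16`) — and link
closure within `Rl = 21/2` (clause 2) ⟹ a bond label `IsBondLabel (1/10000) (145/16) (43/2) S K C lab`.  Side conditions `145/16 + 28/25 + 10⁻⁴ ≤
163/16`, `163/16 + 28/25 + 10⁻⁴ < 13 ≤ 43/2`, `163/16 < 21/2` by `norm_num`. -/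
theorem exists_isBondLabel_of_slabIso_record₂ {aHi δ : ℝ} {S K H : Set E3}
    {L' : E3 →L[ℝ] E3} {w' : ℤ → E3} {U : E3 ≃ₗᵢ[ℝ] E3} {t : E3}
    (haHi : aHi ≤ 1) (hS : IsDoorSetP aHi δ S)
    (hcr : IsCoolShadowCrystal (17 / 20) (1 / 10000) 5 (1 / 10000) 8 10 (43 / 2) S K H L' w' U t)
    {Ψ : ℤ × ℤ × ℤ → E3} {τS : ℤ → Bool} (hΨ : IsBarlowBondChart S Set.univ Ψ τS) (hsurj : ∀ p ∈ S, ∃ x, Ψ x = p)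
    (hfin : Set.Finite {x : ℤ × ℤ × ℤ | ∃ k ∈ K, dist (Ψ x) k ≤ 145 / 16})
    {Φ : ℤ × ℤ × ℤ → E3} {τC : ℤ → Bool} {D : Set (ℤ × ℤ × ℤ)}
    (hΦ : IsBarlowBondChart (placedCrystal L' w' U t) D Φ τC)
    (hlc : ∀ y ∈ D, (∃ k ∈ K, dist (Φ y) k < 21 / 2) → ∀ y' : ℤ × ℤ × ℤ, BarlowAdj τC y y' → y' ∈ D)
    {Θ : ℤ × ℤ × ℤ → ℤ × ℤ × ℤ} {Kread : Set ℤ} (hK : ∀ x : ℤ × ℤ × ℤ, (∃ k ∈ K, dist (Ψ x) k ≤ 179 / 16) → x.1 ∈ Kread)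
    (hX₁ : Function.Injective Θ)
    (hX₂ : ∀ x x' : ℤ × ℤ × ℤ, x.1 ∈ Kread → (BarlowAdj τS x x' ↔ BarlowAdj τC (Θ x) (Θ x')))
    (hX₃ : ∀ y : ℤ × ℤ × ℤ, Ψ y ∈ moatIn S K (145 / 16) (43 / 2) → (∃ k ∈ K, dist (Ψ y) k < 13) →
      Θ y ∈ D ∧ dist (Ψ y) (Φ (Θ y)) ≤ 1 / 10000) :
    ∃ lab : E3 → E3, IsBondLabel (1 / 10000) (145 / 16) (43 / 2) S K (placedCrystal L' w' U t) lab :=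
  exists_isBondLabel_of_slabIso (rI := 163 / 16) (RΘ := 13) haHi hS (by norm_num) (by norm_num)
    (hcr.mono le_rfl le_rfl le_rfl le_rfl (by norm_num) (by norm_num) le_rfl) (by norm_num) (by norm_num) (by norm_num) (by norm_num)
    (by norm_num) hΨ hsurj hfin hΦ hlc hX₁ (fun x x' hx h => (hX₂ x x' hx).1 h) hX₃
    (fun x ⟨k, hk, hxk⟩ => hK x ⟨k, hk, hxk.trans (by norm_num)⟩)

end W1Junctions

end Summit.AtomisticToContinuum.Crystallization.Theorems.ChartedZeroExcessLayeredLatticeLiouville
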